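import Summits.BirchSwinnertonDyer.BirchSwinnertonDyer.Theorems.ManinLocalTwoThreeShimuraQuotientFourP
import Summits.BirchSwinnertonDyer.BirchSwinnertonDyer.Theorems.ManinLocalTwoThreeHalfLatticeVelu
import Summits.BirchSwinnertonDyer.BirchSwinnertonDyer.Theorems.ManinLocalTwoThreeAtMostOneBlindRoot
import Literature.NumberTheory.EllipticCurves.LatticeIndexTwoHalfPeriodProofs
import Literature.NumberTheory.Automorphic.ShimuraCurveRibetTakahashiOptimalProofs
import HarnessLib

/-!
# The Néron bit of the Γ₀/Γ₁ ledger: on a TOTALLY BLIND optimal curve the Shimura cover cannot double the Manin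
# constant unless it has index `4` — so at `N = 4p` (the tame blind family) `|c₀| = |c₁|` UNCONDITIONALLY

Summit `BirchSwinnertonDyer`, route `ManinLocalTwoThree` (cell bsd-f2-manin), deciding crux C2 `ManinOddAtFour`
(stmt-BirchSwinnertonDyer-22967), blind residual (`stub_blindTameOptimalOddDegree` / `stub_rbTotallyBlindWild`; an rows E-an-66
`TotallyBlindGammaOneTransfer`, E-an-67, E-an-54).  THE ARGUMENT (all inputs are tree theorems):

Let `(D₁, D₀)` be the optimal `X₁(N)`/`X₀(N)`-pair of a class (`W₁, W₀` globally minimal, `4 ∣ N`, same newform `f`),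
`W₀ : y² = x³ + a₂x² + a₄x + a₆` with every rational `2`-torsion point Kummer-BLIND, and suppose the DOUBLED alternative
`|c₀| = 2|c₁|` of the ledger (p629489).  Then `Λ_{E₀} = ±2c₁Λ₀(f) ⊆ c₁Λ₁(f) = Λ_{E₁} ⊆ ½Λ_{E₀}` (Ling–Oesterlé
`2Λ₀ ⊆ Λ₁`).  Half-lattice trichotomy (p633660): (i) `Λ_{E₁} = Λ_{E₀}` — then `Λ₁(f) = 2Λ₀(f)`, INDEX `4`;
(ii) `Λ_{E₁} = ½Λ_{E₀}` — then `Λ₁ = Λ₀` and `|c₀| = |c₁|` (homothety engine p629755), contradicting doubling;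
(iii) `Λ_{E₁} = Λ_{E₀} + ℤz₀` has index `2` — then `z₀` is a half-period whose `℘`-value is RATIONAL (both lattices have
rational invariants; `PeriodPair.exists_ratCast_eq_weierstrassP_of_index_two`, p632972), i.e. `T₀ = (e, 0)` is a rational
`2`-torsion point of `W₀`; by hypothesis it is blind; Vélu's lattice (`PeriodPair.lattice_eq_of_velu_invariants`) identifies
`Λ_{E₁}` with the Néron lattice of Vélu's INTEGRAL model `V = [0, −2A, 0, A² − 4B, 0]` of `W₀/⟨T₀⟩`, so `V` and the
globally minimal `W₁` have the same `c₄, c₆`, `V = C • W₁` with `u(C)^12 = 1`; blindness (`2 ∣ A`, `16 ∣ A² − 4B`) makes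
the `u = 2` rescaling of `V` INTEGRAL with discriminant `2⁻¹²Δ(W₁)` — impossible for a globally minimal `W₁`
(`padicValInt_minimalDiscriminantInt_le_padicValRat_Δ_smul`, p618249).  Hence:

* `index_four_of_allBlind_of_natAbs_eq_two_mul` — blind ∧ doubled ⟹ `Λ₁(f) = 2Λ₀(f)` (E-an-68's configuration);
* `natAbs_maninConstant₀_eq_of_allBlind_of_four_mul[_prime]` — **at `N = 4q` (`q` odd, `(ℤ/q)ˣ` cyclic; `N = 4p`) the
  index-`4` configuration is impossible (p632017), so `|c₀| = |c₁|`: E-an-66 `TotallyBlindGammaOneTransfer` HOLDS AT THE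
  LEVELS `4p` of the tame blind family**, and `not_two_dvd_maninConstant₀_iff_of_allBlind_of_four_mul_prime`:
  there C2 for `D₀` ⟺ Stevens' parity `2 ∤ c₁` for `D₁`.

HONEST FRAMING: no Manin constant's parity is decided; C2, Manin's conjecture and BSD are not proved by this.  No definitions.
-/

set_option autoImplicit false
-- the summit-side namespace `Summit.BirchSwinnertonDyer.BirchSwinnertonDyer.…` is the tree's (summit = sub-problem)
set_option linter.dupNamespace false

noncomputable section

open WeierstrassCurve Literature.NumberTheory.EllipticCurves Literature.NumberTheory.EllipticCurves.ModularForms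
open CongruenceSubgroup
open Summit.BirchSwinnertonDyer.Rank1Residual.ManinAdditive.ShimuraLedger
open Summit.BirchSwinnertonDyer.Rank1Residual.ManinAdditive.CuspidalKummer

namespace Summit.BirchSwinnertonDyer.BirchSwinnertonDyer.Theorems.ManinLocalTwoThree

variable {W₁ W₀ : WeierstrassCurve ℚ} [W₁.IsElliptic] [W₁.IsGloballyMinimal] [W₀.IsElliptic]
  [W₀.IsGloballyMinimal] {N : ℕ} [NeZero N]

omit [W₀.IsGloballyMinimal] in
/-- **The Vélu step.**  `W₀ : y² = x³ + a₂x² + a₄x + a₆` (elliptic, `a₁ = a₃ = 0`) with Néron-type pair `L₀`, a BLIND integral root `e` of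
the cubic (`KummerBlindAtTwo a₂ a₄ e`), a half-period `z₀` of `Λ₀` with `℘(z₀) = e + a₂/3`, and a globally minimal `W₁` whose
Néron lattice is `Λ₀ + ℤz₀`: contradiction (the `2`-rescaled Vélu model of `W₀/⟨(e,0)⟩` is an integral model of `W₁` with
discriminant `2⁻¹²Δ_min(W₁)`). -/
theorem false_of_blind_halfPeriod_neronLattice (ha₁ : W₀.a₁ = 0) (ha₃ : W₀.a₃ = 0) {L₀ L₁ : PeriodPair}
    (hL₀ : IsNeronLatticeOf (W₀.baseChange ℂ) L₀) (hL₁ : IsNeronLatticeOf (W₁.baseChange ℂ) L₁)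
    {A₂ A₄ E : ℤ} (hA₂ : (A₂ : ℚ) = W₀.a₂) (hA₄ : (A₄ : ℚ) = W₀.a₄)
    (he : (E : ℚ) ^ 3 + W₀.a₂ * (E : ℚ) ^ 2 + W₀.a₄ * E + W₀.a₆ = 0) (hbl : KummerBlindAtTwo A₂ A₄ E)
    {z₀ : ℂ} (hz₀ : z₀ ∉ L₀.lattice) (h2 : 2 * z₀ ∈ L₀.lattice)
    (hx₀ : (L₀).weierstrassP z₀ = (((E : ℚ) + W₀.a₂ / 3 : ℚ) : ℂ))
    (hle : L₀.lattice ≤ L₁.lattice) (hz₀' : z₀ ∈ L₁.lattice)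
    (hidx : ∀ w ∈ L₁.lattice, w ∈ L₀.lattice ∨ w - z₀ ∈ L₀.lattice) : False := by
  -- the curve-side quantities
  set e : ℚ := (E : ℚ) with he_def
  set q : ℚ := e + W₀.a₂ / 3 with hq_def
  set B : ℚ := 3 * e ^ 2 + 2 * W₀.a₂ * e + W₀.a₄ with hB_def
  have hΔ := Δ_eq_of_isRoot W₀ ha₁ ha₃ he
  have hΔ0 : W₀.Δ ≠ 0 := by rw [← WeierstrassCurve.coe_Δ']; exact W₀.Δ'.ne_zero
  have hB0 : B ≠ 0 := by
    intro hB; apply hΔ0; rw [hΔ, ← hB_def, hB]; ring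
  have hAB : (3 * q) ^ 2 - 4 * B ≠ 0 := by
    intro hAB; apply hΔ0
    have e3 : W₀.a₂ + 3 * e = 3 * q := by rw [hq_def]; ring
    rw [hΔ, ← hB_def, e3, hAB]; ring
  -- Vélu's model and its Néron pair
  set V : WeierstrassCurve ℚ := ⟨0, -2 * (3 * q), 0, (3 * q) ^ 2 - 4 * B, 0⟩ with hV
  haveI hVell : V.IsElliptic := velu_isElliptic hB0 hAB
  haveI : (V.baseChange ℂ).IsElliptic := by rw [WeierstrassCurve.baseChange]; infer_instance
  obtain ⟨LV, hLV⟩ := exists_isNeronLatticeOf_holds (V.baseChange ℂ)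
  have hc₄V : (V.baseChange ℂ).c₄ = (V.c₄ : ℂ) := by simp [WeierstrassCurve.baseChange, WeierstrassCurve.map_c₄]
  have hc₆V : (V.baseChange ℂ).c₆ = (V.c₆ : ℂ) := by simp [WeierstrassCurve.baseChange, WeierstrassCurve.map_c₆]
  have hc₄W₀ : (W₀.baseChange ℂ).c₄ = (W₀.c₄ : ℂ) := by simp [WeierstrassCurve.baseChange, WeierstrassCurve.map_c₄]
  -- `B` in `℘`-terms: `3x₀² − g₂/4 = B`
  have hBc : ((B : ℚ) : ℂ) = 3 * (L₀).weierstrassP z₀ ^ 2 - L₀.g₂ / 4 := by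
    rw [hx₀, hL₀.1, hc₄W₀]
    have h := velu_B_identity W₀ ha₁ ha₃ e
    rw [← hq_def, ← hB_def] at h
    have h' : (((3 * q ^ 2 - W₀.c₄ / 12 / 4 : ℚ)) : ℂ) = ((B : ℚ) : ℂ) := by rw [h]
    push_cast at h' ⊢
    linear_combination -h'
  have hB0c : ((B : ℚ) : ℂ) ≠ 0 := by exact_mod_cast hB0
  have h₂V : LV.g₂ = 12 * (L₀).weierstrassP z₀ ^ 2 + 16 * ((B : ℚ) : ℂ) := by
    rw [hLV.1, hc₄V, hx₀]
    have h := velu_c₄_div (K := ℚ) q B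
    have h' : (((⟨0, -2 * (3 * q), 0, (3 * q) ^ 2 - 4 * B, 0⟩ : WeierstrassCurve ℚ).c₄ / 12 : ℚ) : ℂ) =
        (((12 * q ^ 2 + 16 * B : ℚ)) : ℂ) := by rw [h]
    push_cast at h' ⊢
    rw [hV]; exact h'
  have h₃V : LV.g₃ = -8 * (L₀).weierstrassP z₀ ^ 3 + 32 * ((B : ℚ) : ℂ) * (L₀).weierstrassP z₀ := by
    rw [hLV.2, hc₆V, hx₀]
    have h := velu_c₆_div (K := ℚ) q B
    have h' : (((⟨0, -2 * (3 * q), 0, (3 * q) ^ 2 - 4 * B, 0⟩ : WeierstrassCurve ℚ).c₆ / 216 : ℚ) : ℂ) =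
        (((-8 * q ^ 3 + 32 * B * q : ℚ)) : ℂ) := by rw [h]
    push_cast at h' ⊢
    rw [hV]; exact h'
  -- Vélu's lattice is `Λ₀ + ℤz₀ = Λ₁`
  obtain ⟨hleV, hz₀V, hidxV⟩ := L₀.lattice_eq_of_velu_invariants hz₀ h2 hBc hB0c LV h₂V h₃V
  have hΛ : LV.lattice = L₁.lattice := by
    ext w
    constructor
    · intro hw
      rcases hidxV w hw with h | h
      · exact hle h
      · have e' : w = (w - z₀) + z₀ := by ring
        rw [e']; exact add_mem (hle h) hz₀'
    · intro hw
      rcases hidx w hw with h | h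
      · exact hleV h
      · have e' : w = (w - z₀) + z₀ := by ring
        rw [e']; exact add_mem (hleV h) hz₀V
  -- hence `c₄(V) = c₄(W₁)`, `c₆(V) = c₆(W₁)`
  have hc₄W₁ : (W₁.baseChange ℂ).c₄ = (W₁.c₄ : ℂ) := by simp [WeierstrassCurve.baseChange, WeierstrassCurve.map_c₄]
  have hc₆W₁ : (W₁.baseChange ℂ).c₆ = (W₁.c₆ : ℂ) := by simp [WeierstrassCurve.baseChange, WeierstrassCurve.map_c₆]
  have h4eq : V.c₄ = W₁.c₄ := by
    have h := PeriodPair.g₂_eq_of_lattice_eq hΛ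
    rw [hLV.1, hL₁.1, hc₄V, hc₄W₁] at h
    exact_mod_cast ((div_left_inj' (by norm_num : (12 : ℂ) ≠ 0)).mp h : (V.c₄ : ℂ) = W₁.c₄)
  have h6eq : V.c₆ = W₁.c₆ := by
    have h := PeriodPair.g₃_eq_of_lattice_eq hΛ
    rw [hLV.2, hL₁.2, hc₆V, hc₆W₁] at h
    exact_mod_cast ((div_left_inj' (by norm_num : (216 : ℂ) ≠ 0)).mp h : (V.c₆ : ℂ) = W₁.c₆)
  -- `V = C₁ • W₁` with `u₁¹² = 1`
  obtain ⟨C₁, hC₁⟩ := exists_variableChange_of_c₄_eq_of_c₆_eq (W₁ := W₁) (W₂ := V) one_ne_zero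
    (by rw [h4eq]; simp) (by rw [h6eq]; simp)
  have hΔeq : V.Δ = W₁.Δ := by
    have h1 := V.c_relation
    have h2 := W₁.c_relation
    rw [h4eq, h6eq] at h1
    linear_combination (h1 - h2) / 1728
  have hΔW₁ : W₁.Δ ≠ 0 := by rw [← WeierstrassCurve.coe_Δ']; exact W₁.Δ'.ne_zero
  have hu12 : ((C₁.u⁻¹ : ℚˣ) : ℚ) ^ 12 = 1 := by
    have h : (C₁ • W₁).Δ = ((C₁.u⁻¹ : ℚˣ) : ℚ) ^ 12 * W₁.Δ := by rw [variableChange_Δ]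
    rw [hC₁, hΔeq] at h
    exact (mul_left_eq_self₀.mp h.symm).resolve_right hΔW₁
  -- blindness ⟹ the `u = 2` rescaling of `V` is integral
  obtain ⟨⟨k, hk⟩, ⟨k₄, hk₄⟩⟩ := hbl
  have hA : (3 * q : ℚ) = ((A₂ + 3 * E : ℤ) : ℚ) := by rw [hq_def, he_def]; push_cast; rw [← hA₂]; ring
  have hD : ((3 * q) ^ 2 - 4 * B : ℚ) = (((A₂ + E) ^ 2 - 4 * (A₄ + (A₂ + E) * E) : ℤ) : ℚ) := by
    rw [hq_def, hB_def, he_def]; push_cast; rw [← hA₂, ← hA₄]; ring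
  set C₂ : VariableChange ℚ := ⟨Units.mk0 (2 : ℚ) two_ne_zero, 0, 0, 0⟩ with hC₂
  have hu₂ : ((C₂.u⁻¹ : ℚˣ) : ℚ) = (2 : ℚ)⁻¹ := by rw [Units.val_inv_eq_inv_val, hC₂, Units.val_mk0]
  have hCV : (C₂ * C₁) • W₁ = C₂ • V := by rw [mul_smul, hC₁]
  have h₁' : ((C₂ * C₁) • W₁).a₁ = ((0 : ℤ) : ℚ) := by rw [hCV, variableChange_a₁]; simp [hC₂, hV]
  have h₂' : ((C₂ * C₁) • W₁).a₂ = ((-(k + E) : ℤ) : ℚ) := by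
    rw [hCV, variableChange_a₂, hu₂]
    simp only [hV, hC₂, mul_zero, sub_zero, add_zero, zero_pow two_ne_zero]
    have : (2 : ℚ) * (3 * q) = ((2 * (2 * (k + E)) : ℤ) : ℚ) := by
      rw [hA]; push_cast; rw [show (A₂ : ℚ) + 3 * E = (A₂ + E) + 2 * E by ring]
      have : ((A₂ : ℚ) + E) = k + k := by exact_mod_cast hk
      rw [this]; ring
    push_cast at this ⊢
    linear_combination (-1 / 4 : ℚ) * this
  have h₃' : ((C₂ * C₁) • W₁).a₃ = ((0 : ℤ) : ℚ) := by rw [hCV, variableChange_a₃]; simp [hC₂, hV]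
  have h₄' : ((C₂ * C₁) • W₁).a₄ = ((k₄ : ℤ) : ℚ) := by
    rw [hCV, variableChange_a₄, hu₂]
    simp only [hV, hC₂, mul_zero, sub_zero, add_zero, zero_mul]
    rw [hD, hk₄]; push_cast; ring
  have h₆' : ((C₂ * C₁) • W₁).a₆ = ((0 : ℤ) : ℚ) := by
    rw [hCV, variableChange_a₆, hu₂]; simp [hC₂, hV]
  -- minimality of `W₁` at `2` versus `Δ = 2⁻¹² Δ(W₁)`
  haveI : Fact (Nat.Prime 2) := ⟨Nat.prime_two⟩
  have hle2 := padicValInt_minimalDiscriminantInt_le_padicValRat_Δ_smul W₁ (C₂ * C₁) 0 (-(k + E)) 0 k₄ 0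
    h₁' h₂' h₃' h₄' h₆' 2
  have hΔ' : ((C₂ * C₁) • W₁).Δ = (2 : ℚ)⁻¹ ^ 12 * (W₁.minimalDiscriminantInt : ℚ) := by
    rw [hCV, variableChange_Δ, hu₂, hΔeq, cast_minimalDiscriminantInt]
  have hm : (W₁.minimalDiscriminantInt : ℚ) ≠ 0 := by exact_mod_cast minimalDiscriminantInt_ne_zero W₁
  rw [hΔ', padicValRat.mul (pow_ne_zero _ (inv_ne_zero two_ne_zero)) hm, padicValRat.pow,
    padicValRat.inv, padicValRat.of_int] at hle2
  have h2v : padicValRat 2 (2 : ℚ) = 1 := by exact_mod_cast padicValRat.self (p := 2) one_lt_two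
  rw [h2v] at hle2
  push_cast at hle2
  linarith

/-- **Blind ∧ doubled ⟹ index `4`.**  For the optimal `X₁(N)`/`X₀(N)`-pair `(D₁, D₀)` of a class (`4 ∣ N`, globally
minimal models, `W₀` with `a₁ = a₃ = 0` and ALL rational `2`-torsion Kummer-blind): if `|c₀| = 2|c₁|` then
`Λ₁(f) = 2Λ₀(f)` (E-an-68's configuration).  See the module docstring for the argument. -/
theorem index_four_of_allBlind_of_natAbs_eq_two_mul (D₁ : Gamma1ParametrizationData W₁ N)
    (D₀ : ModularParametrizationData W₀ N) (hiso : IsIsogenous W₁ W₀) (h₁ : D₁.IsOptimal)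
    (h₀ : ∀ z ∈ D₀.L.lattice, ∃ w ∈ periodLattice D₀.f, z = D₀.c * w) (h4 : 2 ^ 2 ∣ N)
    (ha₁ : W₀.a₁ = 0) (ha₃ : W₀.a₃ = 0) (hblind : AllRationalTwoTorsionBlind W₀)
    (hdouble : D₀.maninConstant.natAbs = 2 * D₁.maninConstant.natAbs) :
    ∀ z : ℂ, z ∈ periodLatticeGamma1 D₁.f ↔ ∃ w ∈ periodLattice D₀.f, z = 2 * w := by
  have hf : D₁.f = D₀.f := D₁.f_eq_of_isIsogenous D₀ hiso
  have hc₁ : (D₁.c : ℂ) ≠ 0 := by exact_mod_cast D₁.maninConstant_ne_zero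
  have hc₀ : (D₀.c : ℂ) ≠ 0 := by exact_mod_cast D₀.maninConstant_ne_zero_holds
  -- `c₀ = ε · 2c₁`, `ε = ±1`
  obtain ⟨ε, hε, hcc⟩ : ∃ ε : ℂ, (ε = 1 ∨ ε = -1) ∧ (D₀.c : ℂ) = ε * (2 * D₁.c) := by
    have h : D₀.maninConstant.natAbs = (2 * D₁.maninConstant).natAbs := by rw [hdouble, Int.natAbs_mul]; rfl
    rcases Int.natAbs_eq_natAbs_iff.mp h with h' | h'
    · exact ⟨1, Or.inl rfl, by rw [one_mul]; exact_mod_cast h'⟩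
    · exact ⟨-1, Or.inr rfl, by rw [neg_one_mul]; exact_mod_cast h'⟩
  have hε2 : ε * ε = 1 := by rcases hε with rfl | rfl <;> norm_num
  have hεmem : ∀ (S : AddSubgroup ℂ) (w : ℂ), w ∈ S → ε * w ∈ S := by
    intro S w hw; rcases hε with rfl | rfl
    · rwa [one_mul]
    · rw [neg_one_mul]; exact neg_mem hw
  have hεmem' : ∀ (S : Submodule ℤ ℂ) (w : ℂ), w ∈ S → ε * w ∈ S := by
    intro S w hw; rcases hε with rfl | rfl
    · rwa [one_mul]
    · rw [neg_one_mul]; exact neg_mem hw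
  -- Ling–Oesterlé at the traceless prime `2`: `2Λ₀ ⊆ Λ₁`
  have h2Λ : ∀ w ∈ periodLattice D₀.f, (2 : ℂ) * w ∈ periodLatticeGamma1 D₀.f := fun w hw ↦ by
    have h := pMulLatticeLeGamma1OfTracelessPrime_holds N D₀.f D₀.isNewformOf.1 2 Nat.prime_two
      ((dvd_pow_self 2 two_ne_zero).trans h4) (D₀.isNewformOf.1.cuspCoeff_eq_zero_of_sq_dvd Nat.prime_two h4) w hw
    exact_mod_cast h
  -- `Λ_{E₀} ⊆ Λ_{E₁} ⊆ ½Λ_{E₀}`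
  have hle : D₀.L.lattice ≤ D₁.L.lattice := by
    intro z hz
    obtain ⟨w, hw, rfl⟩ := h₀ z hz
    have h2w : ε * ((2 : ℂ) * w) ∈ periodLatticeGamma1 D₁.f := by rw [hf]; exact hεmem _ _ (h2Λ w hw)
    have e : (D₀.c : ℂ) * w = (D₁.c : ℂ) * (ε * (2 * w)) := by rw [hcc]; ring
    rw [e]
    exact D₁.smul_periodLatticeGamma1_le _ h2w
  have htwo : ∀ w ∈ D₁.L.lattice, 2 * w ∈ D₀.L.lattice := by
    intro w hw
    obtain ⟨w₁, hw₁, rfl⟩ := h₁ w hw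
    have hw₀ : ε * w₁ ∈ periodLattice D₀.f := hεmem _ _ (hf ▸ periodLatticeGamma1_le_periodLattice D₁.f hw₁)
    have e : 2 * ((D₁.c : ℂ) * w₁) = (D₀.c : ℂ) * (ε * w₁) := by
      rw [hcc]; linear_combination -(2 * (D₁.c : ℂ) * w₁) * hε2
    rw [e]
    exact D₀.smul_periodLattice_le _ hw₀
  rcases halfLattice_trichotomy D₀.L D₁.L hle htwo with hcase | hcase | hcase
  -- (i) `Λ_{E₁} = Λ_{E₀}`: index 4
  · intro z
    constructor
    · intro hz
      have hz' : (D₁.c : ℂ) * z ∈ D₀.L.lattice := hcase _ (D₁.smul_periodLatticeGamma1_le z hz)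
      obtain ⟨w, hw, hw'⟩ := h₀ _ hz'
      refine ⟨ε * w, hεmem _ _ hw, ?_⟩
      have h : (D₁.c : ℂ) * z = (D₁.c : ℂ) * (2 * (ε * w)) := by rw [hw', hcc]; ring
      exact mul_left_cancel₀ hc₁ h
    · rintro ⟨w, hw, rfl⟩
      rw [hf]; exact h2Λ w hw
  -- (ii) `Λ_{E₁} ⊇ ½Λ_{E₀}`: then `Λ₁ = Λ₀`, contradicting doubling
  · exfalso
    have hΛ : periodLatticeGamma1 D₀.f = periodLattice D₀.f := by
      refine le_antisymm (periodLatticeGamma1_le_periodLattice D₀.f) fun w hw ↦ ?_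
      have h2h : 2 * (ε * ((D₁.c : ℂ) * w)) ∈ D₀.L.lattice := by
        have e : 2 * (ε * ((D₁.c : ℂ) * w)) = (D₀.c : ℂ) * w := by rw [hcc]; ring
        rw [e]; exact D₀.smul_periodLattice_le w hw
      obtain ⟨w₁, hw₁, hw₁'⟩ := h₁ _ (hcase _ h2h)
      have hw' : w = ε * w₁ := by
        have h : (D₁.c : ℂ) * w = (D₁.c : ℂ) * (ε * w₁) := by
          linear_combination ε * hw₁' - ((D₁.c : ℂ) * w) * hε2
        exact mul_left_cancel₀ hc₁ h
      rw [hw', ← hf]; exact hεmem _ _ hw₁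
    have heq := natAbs_maninConstant₀_eq_of_periodLatticeGamma1_eq_periodLattice D₁ D₀ h₁ h₀ hf hΛ
    have hc₁0 : D₁.maninConstant.natAbs ≠ 0 := Int.natAbs_ne_zero.mpr D₁.maninConstant_ne_zero
    omega
  -- (iii) index 2 with half-period `z₀`: the Vélu contradiction
  · exfalso
    obtain ⟨z₀, hz₀', hz₀, hidx⟩ := hcase
    have hc₄W₀ : (W₀.baseChange ℂ).c₄ = (W₀.c₄ : ℂ) := by simp [WeierstrassCurve.baseChange, WeierstrassCurve.map_c₄]
    have hc₆W₀ : (W₀.baseChange ℂ).c₆ = (W₀.c₆ : ℂ) := by simp [WeierstrassCurve.baseChange, WeierstrassCurve.map_c₆]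
    have hc₄W₁ : (W₁.baseChange ℂ).c₄ = (W₁.c₄ : ℂ) := by simp [WeierstrassCurve.baseChange, WeierstrassCurve.map_c₄]
    have hc₆W₁ : (W₁.baseChange ℂ).c₆ = (W₁.c₆ : ℂ) := by simp [WeierstrassCurve.baseChange, WeierstrassCurve.map_c₆]
    obtain ⟨x, hx⟩ := D₀.L.exists_ratCast_eq_weierstrassP_of_index_two D₁.L hle
      ⟨W₀.c₄ / 12, by rw [D₀.isNeronLattice.1, hc₄W₀]; push_cast; ring⟩
      ⟨W₀.c₆ / 216, by rw [D₀.isNeronLattice.2, hc₆W₀]; push_cast; ring⟩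
      ⟨W₁.c₄ / 12, by rw [D₁.isNeronLattice.1, hc₄W₁]; push_cast; ring⟩
      ⟨W₁.c₆ / 216, by rw [D₁.isNeronLattice.2, hc₆W₁]; push_cast; ring⟩ hz₀' hz₀ hidx
    have h2z₀ : 2 * z₀ ∈ D₀.L.lattice := htwo z₀ hz₀'
    -- `x = ℘(z₀)` is a root of `4x³ − g₂x − g₃`, so `e = x − a₂/3` is a rational root of the `2`-division cubic
    have hcubic : 4 * (D₀.L).weierstrassP z₀ ^ 3 - D₀.L.g₂ * (D₀.L).weierstrassP z₀ - D₀.L.g₃ = 0 := by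
      rw [← D₀.L.derivWeierstrassP_sq z₀ hz₀, D₀.L.derivWeierstrassP_eq_zero_of_two_mul_mem h2z₀]; ring
    set e : ℚ := x - W₀.a₂ / 3 with he_def
    have heC := isRoot_cubic_of_weierstrassP_sub W₀ ha₁ ha₃ D₀.isNeronLattice hcubic
    rw [← hx] at heC
    have he : e ^ 3 + W₀.a₂ * e ^ 2 + W₀.a₄ * e + W₀.a₆ = 0 := by
      have h : (((e ^ 3 + W₀.a₂ * e ^ 2 + W₀.a₄ * e + W₀.a₆ : ℚ)) : ℂ) = 0 := by
        rw [he_def]; push_cast; exact heC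
      exact_mod_cast h
    obtain ⟨A₂, A₄, E, hA₂, hA₄, hE, hbl⟩ := hblind e he
    have heE : ((E : ℚ) : ℚ) ^ 3 + W₀.a₂ * (E : ℚ) ^ 2 + W₀.a₄ * E + W₀.a₆ = 0 := by rw [hE]; exact he
    have hx₀ : (D₀.L).weierstrassP z₀ = (((E : ℚ) + W₀.a₂ / 3 : ℚ) : ℂ) := by rw [hE, he_def, ← hx]; push_cast; ring
    exact false_of_blind_halfPeriod_neronLattice ha₁ ha₃ D₀.isNeronLattice D₁.isNeronLattice hA₂ hA₄ heE hbl
      hz₀ h2z₀ hx₀ hle hz₀' hidx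

end Summit.BirchSwinnertonDyer.BirchSwinnertonDyer.Theorems.ManinLocalTwoThree

end
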